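/- Copyright: the b2b-balaban cell (near-miss cell 7), T⁴-continuum fan-out; row NE7b CRUX team (2), seat
t4-ne7b-formalise-leaf-03 (gen 26) — custodian's part of the OWNER's INTERFACE REQUEST NE7b IR-45-1 ∕ RULING R-OWNER-46-1
(«THE (α) SUPPLIER PLUG OF `priceM`∕`upM` OVER M2 BRICK B → S12-W crew (leaf-03 custodian; E-side leaf-02; leaf-05)»,
HOME/INBOX.md l.8656, `CLAIMS.log` l.31391 ∕ l.31568 ∕ claim l.31515), part 2 of 2.  Released under the licence of the
surrounding project. -/
import Summits.QuantumFields.BalabanUV.T4Continuum.Support.B16HistoryWeightPlug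
import Summits.QuantumFields.BalabanUV.T4Continuum.Support.HistoryBankingCreditRead
import Summits.QuantumFields.BalabanUV.T4Continuum.Support.HistoryAssemblyMultKey

/-!
# M2 brick B → the END's witness, part 2: THE NUMERATOR READING `upM`, THE DEAD WEIGHT AND THE TERM-FREE ENVELOPE,
# AND `resumM` FROM THE FIBRE-MASS DISPLAY, in the pass-V currency (re-open object (α) of row NE7b, `SCOPE-alpha.md` §5
rows M2∕M5; INTERFACE REQUEST NE7b IR-45-1 of the row owner `t4-ne7b-p1` gen 45 as amended by RULING R-OWNER-46-1 «M5-4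
THE FIBRE READING» (gen 46); lineage `t4-ne7b-formalise-leaf-03` gen 26, custodian of the S12-W crew)

Summits-side support leaf of the T⁴-continuum cell (rung (B)+1 on a FINITE torus only; NOT infinite volume, NOT the
mass gap, NOT the Clay statement; NOT a proof of the spine estimate NE7b — the cell's OWN estimate, NOT PRINTED, NOT
PROVED).  [folklore] finite bookkeeping BY NAME over the owner's M5-2 `B16HistoryWeightPlug.weight_le_live_mul_dead`
(`weight ≤ LIVE · DEAD · rest`), M2-B (`B16HistoryInputFamily`: `HistReading`, `HistFactors`, `HistRead`, `inputOf`,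
`rest`), the owner's pass-V junction (`HistoryGenealogyJunctionV`: `InputFamily.pedV`∕`liveCV`∕`ZV`,
`realisedDomainsRW_of_familyV`), `HistoryBankingCreditRead.evProd_nonneg` and the lineage's member ∕ key families
(`HistoryAssemblyPedigree.memOf`, `HistoryAssemblyMultKey.kmemOf`, `HistoryAssemblyMult.badGMems`,
`T4LiveClassFibration.fibre`); three plain real-valued bookkeeping functions (`dmassOf`, `deadOf`, `nupOf`), no
`structure`, no `[cite:]` tag, nothing printed asserted, no `Prop` fact minted, zero `sorry`.  B16 =
[Balaban1989LargeFieldII] pp. 378–390 is a manuscript UNDER AUDIT; nothing of it is read here beyond what the imported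
modules display (R-OWNER-46-1 (0) quotes p. 383, (1.90)∕(1.97)–(1.100) pp. 388–390 and (1.68)∕(1.69) p. 377 as LOCATORS of
the fibre reading; nothing asserted).

WHY.  The VS-witness `CountRoadWitnessT3bWTVS` (leaf-02, p265435) asks, per cutoff `K ≥ K₀` and `|t| ≤ l₀`, for
`upM : A K t τ ≤ dead K t τ · FcM K k · nup K t` on every term `τ` of the key fibre of a bad key class `k`, `dead ≥ 0`
(`deadM_nonneg`), `Σ_{τ ∈ fibre k} dead K t τ ≤ RfM K k` (`resumM`) and `0 ≤ nup K t ≤ Nup` (`nup_bd`).  With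
`T := HIndex.termSet I`, `A K t := Repr172R.weight μ Rp t` (M2-A) and the pass-V reading maps of M2-B's read inputs
(`ped := ℛ.inputOf.pedV`, `cellP := fun _ _ => id`, `liveC := ℛ.inputOf.liveCV`, `Zd := ℛ.inputOf.ZV`; `realised` is
`realisedDomainsRW_of_familyV` verbatim), M2-B reads `A K t τ ≤ LIVE(τ)·DEAD(τ)·rest(t,τ)`.  THE LAYOUT follows two located
typing points and the owner's ruling: (1) F-ne7bleaf02g28-1 (journal l.31462) — `FcM K` is keyed by the KEY family
`kmemOf` (root cell, FLAT genealogy, physical datum), so `FcM` stays ABSTRACT here with the one-sided key reading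
`hFcM : LIVE(τ) ≤ FcM K (kmemOf … K τ)` (R-OWNER-46-1 (c): `FcM := LIVE` read on the key by node sums — leaf-02's
`HistoryPriceKeys`, which gives `hFcM` with equality); (2) F-ne7bleaf03g26-1 (l.31515) as amended by R-OWNER-46-1 (b) —
the witness's `nup K t` is TERM-FREE while `rest(t,τ) = e^{BA K t}·(wC K t a c·e^{BV K t a h l c})·mass K` is not, so with
a displayed TERM-FREE curly normalisation envelope `W K > 0`: `dead K t τ := DEAD(τ)·|wC(τ)|·e^{BV(τ)} ∕ W K` (`deadOf`,
unconditionally `≥ 0`) and `nup K t := e^{BA K t}·mass K·W K` (`nupOf`); (3) R-OWNER-46-1 (c) — `resumM` is the located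
VOLUME-TYPE display (ρ) `FibreMass` «`Σ_{τ ∈ fibre k} DEAD(τ)·|wC(τ)|·e^{BV(τ)} ≤ W K · MULT K k`» divided by `W K`.

WHAT.  §2 `dmassOf` (a term's fibre mass `DEAD·|wC|·e^{BV}`), `deadOf`, `nupOf`; `dmassOf_nonneg` ∕ `deadOf_nonneg`
(nonnegative birth ∕ renewal factors — `FactorRead`'s first clauses), `nupOf_nonneg`, **`nupOf_le`** (term-free displays
`BA K t ≤ B∞`, `mass K ≤ m∞`, `W K ≤ W∞` ⇒ `nupOf K t ≤ e^{B∞}·m∞·W∞` = the `Nup` of the ruling), `rest_le_split`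
(`rest ≤ (|wC|·e^{BV} ∕ W K)·nupOf`), `abs_wC_eq_of_nonempty` (`|wC| = wC` on an inhabited space, `HistRead.tc_le`).
§3 **`weight_le_deadOf_mul_mul_nupOf`** (per term `⟨K, a, (h, ℓ, c)⟩`; binders = `weight_le_live_mul_dead`'s VERBATIM at
the reading's letters + `fB, fR ≥ 0` + `0 < W K` + `cellOf`, `phys` + `hFcM`): `weight μ Rp t ⟨K,a,(h,ℓ,c)⟩ ≤ deadOf ℛ Φf W K t
⟨K,a,(h,ℓ,c)⟩ · FcM K (kmemOf …) · nupOf Φf mass W K t`.  §4 THE WITNESS-SHAPED FIELDS at a cutoff `K ≥ K₀`, `|t| ≤ l₀`, the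
per-term conditions quantified over `termSet I K`: **`upM_of_reading`**, **`deadM_nonneg_of_reading`**,
**`resumM_of_fibreMass`** ((ρ) ⇒ `Σ_{τ ∈ fibre k} deadOf … ≤ MULT K k`, i.e. `resumM` at `RfM := MULT`), `nupOf_measure_nonneg`.
Part 1 (`HistoryRealiseCellsRunSupplyMembers`) carries the member identification `prod_memOf_pedV_eq` ∕
`prod_kmemOf_pedV_eq` by which leaf-02's key reading meets `LIVE(τ)`.

HONEST SCOPE.  Bookkeeping; every display is a HYPOTHESIS (R-class): `HistRead` (M2-B's identification), the pass-V
process conditions, the calibrated volume displays (M5-2), nonnegative factors (`FactorRead`), the curly normalisation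
envelope `W` with `W∞`, the key reading `hFcM` (leaf-02's module B), the fibre mass (ρ) (located, volume type; its
right-hand side cannot absorb a missing small factor).  NOT HERE: `FcM := LIVE`∕`RfM := MULT` read on keys (leaf-02),
`priceM` (`LIVE·MULT ≤ PRICE`, the owner's M5-4a `HistoryBankingFibreRoom` ∘ module B), `reprA`∕`reprB`, the
(γ)∕NE7∕NE7c fields.  BY-NAME EFFECT ON THE WALL (with module B): `upM`, `deadM_nonneg`, `FM_nonneg` kernel modulo
displays; `resumM` R AS the located display (ρ) + `W∞`.  NE7b NOT proved; spine 0∕9.  HONEST DEPENDENCY (cell):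
continuum YM on T⁴ ⇐ BetaPertH ∧ nine spine estimates (0/9 proved); BetaPertH ⇐ (D1) ∧ (D4) ∧ CAP+tail; G-an2-4 gates
asym, D1 and NE2/3/4.  This file changes none of it.
-/

open Finset MeasureTheory
open Literature.MathematicalPhysics.QuantumFieldTheory.Balaban1983to89
open Literature.MathematicalPhysics.QuantumFieldTheory.Balaban1983to89.B13ScaleTransfer
open Literature.MathematicalPhysics.QuantumFieldTheory.Balaban1983to89.B16SProfile
open T4PersistenceDictionary T4PrintedShapeBanking T4TaggedShapeBanking T4BankedInduction T4PartnerMultiplicity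
open T4LiveClassFibration
open Summit.QuantumFields.BalabanUV.T4Continuum.HistoryAdmissible
open Summit.QuantumFields.BalabanUV.T4Continuum.HistoryGen
open Summit.QuantumFields.BalabanUV.T4Continuum.HistoryGenealogyExtraction
open Summit.QuantumFields.BalabanUV.T4Continuum.HistoryGenealogyRealise
open Summit.QuantumFields.BalabanUV.T4Continuum.HistoryGenealogyInstantiate
open Summit.QuantumFields.BalabanUV.T4Continuum.HistoryGenealogyPedigree
open Summit.QuantumFields.BalabanUV.T4Continuum.B16HistoryIndexedRepr
open Summit.QuantumFields.BalabanUV.T4Continuum.HistoryBankingLE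
open Summit.QuantumFields.BalabanUV.T4Continuum.HistoryConstants
open Summit.QuantumFields.BalabanUV.T4Continuum.HistoryBankingForestVolume
open Summit.QuantumFields.BalabanUV.T4Continuum.HistoryBankingVolumePlug
open Summit.QuantumFields.BalabanUV.T4Continuum.HistoryBankingForestPlug
open Summit.QuantumFields.BalabanUV.T4Continuum.HistoryBankingCreditRead
open Summit.QuantumFields.BalabanUV.T4Continuum.B16HistoryWeightPlug
open Summit.QuantumFields.BalabanUV.T4Continuum.HistoryAssemblyTerms
open Summit.QuantumFields.BalabanUV.T4Continuum.HistoryAssemblyPedigree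
open Summit.QuantumFields.BalabanUV.T4Continuum.HistoryAssemblyMult
open Summit.QuantumFields.BalabanUV.T4Continuum.HistoryAssemblyMultKey

namespace Summit.QuantumFields.BalabanUV.T4Continuum.HistoryRealiseCellsRunSupplyWTVS

noncomputable section

-- the structural `DecidableEq` instance of the concrete tag type exceeds the default synthesis size (as in the
-- siblings `B16HistoryWeightPlug` ∕ `B16HistoryPricePlug`)
set_option synthInstance.maxSize 1024

/-! ## §2 The fibre mass of a term, the dead weight and the term-free envelope (R-OWNER-46-1 (b)) -/

section Envelope

variable {DomK : ℕ → Type*} {I : (K : ℕ) → HIndex (DomK K)} {d : ℕ}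

/-- **THE FIBRE MASS OF A TERM** `τ = ⟨K, a, (h, ℓ, c)⟩` at source value `t`: the dead genealogies' tree volumes and
event products of its run (`DEAD(τ) = ∏_{j<K} ∏_{x ∈ histV.died j} e^{treeVol}·evProd`, the DEAD factor of M2-B's
`weight_le_live_mul_dead`) times the curly envelope and the last-exponent envelope of its history choice
(`|wC K t a c|·e^{BV K t a h ℓ c}` — the term-dependent part of M2-B's `rest`); the summand of the located display (ρ)
`FibreMass` of R-OWNER-46-1. [folklore] -/
def dmassOf (ℛ : HistReading I d) (Φf : HistFactors I d) (t : ℝ) : HIndex.Idx I → ℝ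
  | ⟨K, a, (h, l, c)⟩ =>
    (∏ j ∈ Finset.range K, ∏ x ∈ (ℛ.runOf K a (h, l, c)).histV.died j,
        Real.exp (treeVol (ℛ.runOf K a (h, l, c)).L (ℛ.runOf K a (h, l, c)).s (fun v => (v : ℝ))
            (ℛ.runOf K a (h, l, c)).pedMV (fun j => Real.log (Φf.Λ K j)) j (j, x)) *
          evProd (Φf.fB K) (Φf.fR K) ((ℛ.runOf K a (h, l, c)).pedMV.toPGen id (j, x))) *
      (|Φf.wC K t a c| * Real.exp (Φf.BV K t a h l c))

/-- **THE DEAD WEIGHT** `dead K t τ`: the fibre mass over the displayed term-free curly normalisation envelope `W K`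
(R-OWNER-46-1 (b): `deadOf := DEAD·|wC|·e^{BV} ∕ W K`). [folklore] -/
def deadOf (ℛ : HistReading I d) (Φf : HistFactors I d) (W : ℕ → ℝ) (K : ℕ) (t : ℝ) (τ : HIndex.Idx I) : ℝ :=
  dmassOf ℛ Φf t τ / W K

/-- **THE TERM-FREE ENVELOPE** `nup K t`: the completed-action envelope, the total mass of the cutoff's reference measure
and the curly normalisation envelope (R-OWNER-46-1 (b): `nupOf := e^{BA K t}·mass K·W K`). [folklore] -/
def nupOf (Φf : HistFactors I d) (mass W : ℕ → ℝ) (K : ℕ) (t : ℝ) : ℝ := Real.exp (Φf.BA K t) * mass K * W K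

variable (ℛ : HistReading I d) (Φf : HistFactors I d)

/-- the fibre mass of a term is nonnegative (birth and renewal factors nonnegative — `FactorRead`'s first two clauses)
[folklore] -/
theorem dmassOf_nonneg {K : ℕ} (hB : ∀ j d' n, 0 ≤ Φf.fB K j d' n) (hRf : ∀ h, 0 ≤ Φf.fR K h) (t : ℝ)
    (a : (I K).Adm) (h : (I K).HZ) (l : (I K).HL) (c : (I K).HC) : 0 ≤ dmassOf ℛ Φf t ⟨K, a, (h, l, c)⟩ := by
  rw [dmassOf]
  exact mul_nonneg (Finset.prod_nonneg fun j _ => Finset.prod_nonneg fun x _ =>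
    mul_nonneg (Real.exp_pos _).le (evProd_nonneg hB hRf _)) (mul_nonneg (abs_nonneg _) (Real.exp_pos _).le)

/-- the dead weight is nonnegative (`W K ≥ 0`) [folklore] -/
theorem deadOf_nonneg {W : ℕ → ℝ} {K : ℕ} (hW : 0 ≤ W K) (hB : ∀ j d' n, 0 ≤ Φf.fB K j d' n)
    (hRf : ∀ h, 0 ≤ Φf.fR K h) (t : ℝ) (a : (I K).Adm) (h : (I K).HZ) (l : (I K).HL) (c : (I K).HC) :
    0 ≤ deadOf ℛ Φf W K t ⟨K, a, (h, l, c)⟩ :=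
  div_nonneg (dmassOf_nonneg ℛ Φf hB hRf t a h l c) hW

/-- the term-free envelope is nonnegative (`mass, W ≥ 0`) [folklore] -/
theorem nupOf_nonneg {mass W : ℕ → ℝ} (hmass : ∀ K, 0 ≤ mass K) (hW : ∀ K, 0 ≤ W K) (K : ℕ) (t : ℝ) :
    0 ≤ nupOf Φf mass W K t :=
  mul_nonneg (mul_nonneg (Real.exp_pos _).le (hmass K)) (hW K)

/-- **THE ENVELOPE FIELD's UPPER HALF** from term-free displays: `BA K t ≤ B∞`, `mass K ≤ m∞`, `W K ≤ W∞` (with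
`mass, W ≥ 0`) give `nupOf K t ≤ e^{B∞}·m∞·W∞` (R-OWNER-46-1 (b)'s `Nup`). [folklore] -/
theorem nupOf_le {mass W : ℕ → ℝ} {K : ℕ} {t B m Wi : ℝ} (hmass : 0 ≤ mass K) (hW : 0 ≤ W K) (hBA : Φf.BA K t ≤ B)
    (hm : mass K ≤ m) (hWi : W K ≤ Wi) : nupOf Φf mass W K t ≤ Real.exp B * m * Wi := by
  unfold nupOf
  have h1 : Real.exp (Φf.BA K t) ≤ Real.exp B := Real.exp_le_exp.2 hBA
  have hm0 : 0 ≤ m := hmass.trans hm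
  calc Real.exp (Φf.BA K t) * mass K * W K ≤ Real.exp B * m * W K :=
        mul_le_mul_of_nonneg_right (mul_le_mul h1 hm hmass (Real.exp_pos _).le) hW
    _ ≤ Real.exp B * m * Wi := mul_le_mul_of_nonneg_left hWi (mul_nonneg (Real.exp_pos _).le hm0)

/-- **M2-B's ENVELOPE SPLITS**: `rest t τ = e^{BA}·(wC·e^{BV})·mass ≤ (|wC|·e^{BV} ∕ W K) · nupOf K t` for a nonnegative
mass and `0 < W K`. [folklore] -/
theorem rest_le_split {mass W : ℕ → ℝ} (hmass : ∀ K, 0 ≤ mass K) {K : ℕ} (hW : 0 < W K) (t : ℝ) (a : (I K).Adm)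
    (h : (I K).HZ) (l : (I K).HL) (c : (I K).HC) :
    Φf.rest mass t ⟨K, a, (h, l, c)⟩ ≤
      |Φf.wC K t a c| * Real.exp (Φf.BV K t a h l c) / W K * nupOf Φf mass W K t := by
  rw [HistFactors.rest, nupOf]
  have h1 : Φf.wC K t a c * Real.exp (Φf.BV K t a h l c) ≤ |Φf.wC K t a c| * Real.exp (Φf.BV K t a h l c) :=
    mul_le_mul_of_nonneg_right (le_abs_self _) (Real.exp_pos _).le
  calc Real.exp (Φf.BA K t) * (Φf.wC K t a c * Real.exp (Φf.BV K t a h l c)) * mass K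
      ≤ Real.exp (Φf.BA K t) * (|Φf.wC K t a c| * Real.exp (Φf.BV K t a h l c)) * mass K :=
        mul_le_mul_of_nonneg_right (mul_le_mul_of_nonneg_left h1 (Real.exp_pos _).le) (hmass K)
    _ = _ := by field_simp

/-- on an INHABITED reference space the curly envelope is nonnegative (`HistRead.tc_le` above the unit weight's
nonnegative image), so `|wC| = wC` there — the bridge for the fibre-mass display (ρ). [folklore] -/
theorem abs_wC_eq_of_nonempty {X : ℕ → Type*} {𝒢 : (K : ℕ) → GoodClass (X K)}
    {Rp : (K : ℕ) → ℝ → Repr172R (𝒢 K) (I K)} {l₀ : ℝ} {K₀ : ℕ} (hR : HistRead ℛ Φf Rp l₀ K₀) {K : ℕ}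
    (hK : K₀ ≤ K) {t : ℝ} (ht : |t| ≤ l₀) (a : (I K).Adm) {c : (I K).HC} (hc : c ∈ (I K).HCs a) (x : X K) :
    |Φf.wC K t a c| = Φf.wC K t a c :=
  abs_of_nonneg ((((Rp K t).TC a c).one_nonneg x).trans (hR.tc_le K t ht hK a c hc x))

end Envelope

/-! ## §3 The numerator reading of one term: `weight ≤ deadOf · FcM (key family) · nupOf` (LIVE level, M5-2) -/

section Term

variable {DomK : ℕ → Type*} {I : (K : ℕ) → HIndex (DomK K)} {d : ℕ} {X : ℕ → Type*}
  {𝒢 : (K : ℕ) → GoodClass (X K)} {γ δ : Type*} [DecidableEq γ] [DecidableEq δ]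

/-- **THE NUMERATOR READING OF ONE (1.72) TERM** `⟨K, a, (h, ℓ, c)⟩` (M2 brick B × M5-2 re-split, R-OWNER-46-1 (c) `upM`):
under ALL the hypotheses of M2-B's `B16HistoryWeightPlug.weight_le_live_mul_dead` VERBATIM at the reading's letters (the
displayed identification `HistRead`, the pass-V process conditions of the run read off the term, `4 ≤ L` with drop
control, sizes `≥ 1`, `13 ≤ n₁`, `E₂, E₃ ≥ 0`, the calibrated volume displays), nonnegative birth ∕ renewal factors
(`FactorRead`'s first clauses), the curly normalisation envelope `0 < W K`, and the ONE-SIDED KEY READING `hFcM` of an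
abstract live price `FcM` (M2-B's LIVE product of the term — `∏_{x ∈ histV.comp K} e^{lifeCost}·e^{birthWT (uV K)}·evProd`,
`uV K n := 2^{d+3}·log Λ K n` — is at most `FcM K` of the term's KEY family; leaf-02's `HistoryPriceKeys` gives it with
equality, by node sums): `weight μ Rp t ⟨K, a, (h,ℓ,c)⟩ ≤ deadOf ℛ Φf W K t ⟨K, a, (h,ℓ,c)⟩ · FcM K (kmemOf …) · nupOf Φf mass W K t`.
[folklore] -/
theorem weight_le_deadOf_mul_mul_nupOf [∀ K, MeasurableSpace (X K)] (ℛ : HistReading I d) (Φf : HistFactors I d)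
    (μ : (K : ℕ) → Measure (X K)) [∀ K, IsFiniteMeasure (μ K)] (Rp : (K : ℕ) → ℝ → Repr172R (𝒢 K) (I K))
    {l₀ : ℝ} {K₀ : ℕ} (hR : HistRead ℛ Φf Rp l₀ K₀) {K : ℕ} (hK : K₀ ≤ K) {t : ℝ} (ht : |t| ≤ l₀)
    (a : (I K).Adm) {h : (I K).HZ} {l : (I K).HL} {c : (I K).HC} (hι : (h, l, c) ∈ (I K).LIdx a)
    (hN : (ℛ.runOf K a (h, l, c)).NewOK)
    (hRm : ∀ t k, (ℛ.runOf K a (h, l, c)).Rm t k ≤ (ℛ.runOf K a (h, l, c)).R t)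
    (hRmS : ∀ t k, (ℛ.runOf K a (h, l, c)).Rm t (k + 1) ≤ (ℛ.runOf K a (h, l, c)).R (t + 1))
    (hRm2 : ∀ t, 2 ≤ (ℛ.runOf K a (h, l, c)).Rm t 1) (hD : (ℛ.runOf K a (h, l, c)).NewDisjoint)
    (hL0 : 0 < ℛ.L) (hL4 : 4 ≤ ℛ.L) (hdrop : ∀ m, DropCtl (ℛ.s K) m) (hR1 : ∀ t, 1 ≤ ℛ.R K t)
    {C : T4PrintedShapeBanking.Consts} (hn₁ : 13 ≤ C.n₁) (hE₂ : 0 ≤ C.E₂) (hE₃ : 0 ≤ C.E₃) {Lu : ℝ} (hLu0 : 0 < Lu)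
    {j : ℕ} (hj1 : 1 ≤ j) (hLu : ∀ t i, i ≤ j → Real.log (Φf.Λ K (t + i)) ≤ Lu * Real.log (Φf.Λ K t))
    (hsmall : (1122 : ℝ) ^ d * 16 * 21 ^ d * Lu ≤ 2 ^ j / 2)
    (huΦ : ∀ t, t ≤ K → Real.log (Φf.Λ K t) * (6 * (561 ^ d * j * Lu + 1122 ^ d * Lu)) ≤ floorK C K (ℛ.R K) t)
    (huE₂ : ∀ n, n ≤ K → Real.log (Φf.Λ K n) * (15 * 126 ^ d) ≤ C.E₂ * (ℛ.R K n : ℝ) ^ C.q')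
    (huE₃ : ∀ n, n ≤ K → Real.log (Φf.Λ K n) * (24 * 126 ^ d) ≤ C.E₃ * (ℛ.R K n : ℝ) ^ C.q')
    -- nonnegative birth ∕ renewal factors (`FactorRead.fB_nonneg` ∕ `fR_nonneg`) and the curly normalisation envelope
    (hB : ∀ j d' n, 0 ≤ Φf.fB K j d' n) (hRf : ∀ h, 0 ≤ Φf.fR K h) {W : ℕ → ℝ} (hW : 0 < W K)
    -- the root-cell and physical readings of the END
    (cellOf : ℕ → HIndex.Idx I → ℕ × Lab d → γ) (phys : ℕ → HIndex.Idx I → ℕ × Lab d → δ)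
    -- the live price of the KEY family, read one-sidedly against M2-B's LIVE product of the term
    {FcM : ℕ → Finset (γ × Gen PEv × δ) → ℝ}
    (hFcM : ∏ x ∈ (ℛ.runOf K a (h, l, c)).histV.comp K,
        Real.exp (lifeCost (dictWT Prod.fst (ℛ.R K) C.n₁) (costT Prod.fst C K (ℛ.R K))
            ((ℛ.runOf K a (h, l, c)).pedMV.genT (K, x))) *
          Real.exp (birthWT Prod.fst (fun n => 2 ^ (d + 3) * Real.log (Φf.Λ K n))
            ((ℛ.runOf K a (h, l, c)).pedMV.genT (K, x))) *
          evProd (Φf.fB K) (Φf.fR K) ((ℛ.runOf K a (h, l, c)).pedMV.toPGen id (K, x)) ≤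
      FcM K (kmemOf ℛ.inputOf.pedV ℛ.inputOf.liveCV cellOf phys K ⟨K, a, (h, l, c)⟩)) :
    Repr172R.weight μ Rp t ⟨K, a, (h, l, c)⟩ ≤
      deadOf ℛ Φf W K t ⟨K, a, (h, l, c)⟩ *
        FcM K (kmemOf ℛ.inputOf.pedV ℛ.inputOf.liveCV cellOf phys K ⟨K, a, (h, l, c)⟩) *
        nupOf Φf (fun K => (μ K).real Set.univ) W K t := by
  have hw := weight_le_live_mul_dead ℛ Φf μ Rp hR hK ht a hι hN hRm hRmS hRm2 hD hL0 hL4 hdrop hR1 hn₁ hE₂ hE₃ hLu0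
    hj1 hLu hsmall huΦ huE₂ huE₃
  set J := ℛ.runOf K a (h, l, c) with hJ
  set LIVE := ∏ x ∈ J.histV.comp K,
      Real.exp (lifeCost (dictWT Prod.fst J.R C.n₁) (costT Prod.fst C K J.R) (J.pedMV.genT (K, x))) *
        Real.exp (birthWT Prod.fst (fun n => 2 ^ (d + 3) * Real.log (Φf.Λ K n)) (J.pedMV.genT (K, x))) *
        evProd (Φf.fB K) (Φf.fR K) (J.pedMV.toPGen id (K, x)) with hLIVE
  set DEAD := ∏ j ∈ Finset.range K, ∏ x ∈ J.histV.died j,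
      Real.exp (treeVol J.L J.s (fun v => (v : ℝ)) J.pedMV (fun j => Real.log (Φf.Λ K j)) j (j, x)) *
        evProd (Φf.fB K) (Φf.fR K) (J.pedMV.toPGen id (j, x)) with hDEAD
  set FC := FcM K (kmemOf ℛ.inputOf.pedV ℛ.inputOf.liveCV cellOf phys K ⟨K, a, (h, l, c)⟩) with hFC
  have hLIVE0 : 0 ≤ LIVE := Finset.prod_nonneg fun x _ =>
    mul_nonneg (mul_nonneg (Real.exp_pos _).le (Real.exp_pos _).le) (evProd_nonneg hB hRf _)
  have hDEAD0 : 0 ≤ DEAD := Finset.prod_nonneg fun j _ => Finset.prod_nonneg fun x _ =>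
    mul_nonneg (Real.exp_pos _).le (evProd_nonneg hB hRf _)
  have hLF : LIVE ≤ FC := hFcM
  -- the envelope: `wC ≤ |wC|`, re-split over `W K`
  have hmass : ∀ K, 0 ≤ (μ K).real Set.univ := fun K => measureReal_nonneg
  have hrest : Real.exp (Φf.BA K t) * (Φf.wC K t a c * Real.exp (Φf.BV K t a h l c)) * (μ K).real Set.univ ≤
      |Φf.wC K t a c| * Real.exp (Φf.BV K t a h l c) / W K * nupOf Φf (fun K => (μ K).real Set.univ) W K t :=
    rest_le_split Φf hmass hW t a h l c
  have hE : 0 ≤ |Φf.wC K t a c| * Real.exp (Φf.BV K t a h l c) / W K *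
      nupOf Φf (fun K => (μ K).real Set.univ) W K t :=
    mul_nonneg (div_nonneg (mul_nonneg (abs_nonneg _) (Real.exp_pos _).le) hW.le)
      (nupOf_nonneg Φf hmass (fun _ => hW.le) K t)
  have hdead : deadOf ℛ Φf W K t ⟨K, a, (h, l, c)⟩ =
      DEAD * (|Φf.wC K t a c| * Real.exp (Φf.BV K t a h l c)) / W K := by
    rw [deadOf, dmassOf]
  calc Repr172R.weight μ Rp t ⟨K, a, (h, l, c)⟩
      ≤ LIVE * DEAD * (Real.exp (Φf.BA K t) * (Φf.wC K t a c * Real.exp (Φf.BV K t a h l c)) *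
          (μ K).real Set.univ) := hw
    _ ≤ LIVE * DEAD * (|Φf.wC K t a c| * Real.exp (Φf.BV K t a h l c) / W K *
          nupOf Φf (fun K => (μ K).real Set.univ) W K t) := mul_le_mul_of_nonneg_left hrest (mul_nonneg hLIVE0 hDEAD0)
    _ ≤ FC * DEAD * (|Φf.wC K t a c| * Real.exp (Φf.BV K t a h l c) / W K *
          nupOf Φf (fun K => (μ K).real Set.univ) W K t) :=
        mul_le_mul_of_nonneg_right (mul_le_mul_of_nonneg_right hLF hDEAD0) hE
    _ = _ := by rw [hdead]; ring

end Term

/-! ## §4 The witness-shaped fields at a cutoff: `upM`, `deadM_nonneg`, `resumM` over the key fibres of the bad classes -/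

section Fields

variable {DomK : ℕ → Type*} {I : (K : ℕ) → HIndex (DomK K)} {d : ℕ} {X : ℕ → Type*}
  {𝒢 : (K : ℕ) → GoodClass (X K)} {γ δ : Type*} [DecidableEq γ] [DecidableEq δ]

/-- **`upM` OF THE VS-WITNESS, SUPPLIED FROM THE READING** at a cutoff `K ≥ K₀` and source value `|t| ≤ l₀` (R-OWNER-46-1
(c) «`upM` := M2-B's `weight_le_live_mul_dead` re-split, kernel»): with the per-term pass-V process conditions quantified
over `termSet I K`, the cutoff's displays (`HistRead`, volume, nonnegative factors, `0 < W K`), and the one-sided key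
reading `hFcM` of the abstract live price `FcM` on every term of `termSet I K` — for every bad key class `k` and every
term `τ` of its key fibre, `weight μ Rp t τ ≤ deadOf ℛ Φf W K t τ · FcM K k · nupOf Φf mass W K t` (the field `upM`
at `T := termSet I`, `A K t := weight μ Rp t`, `ped := ℛ.inputOf.pedV`, `liveC := ℛ.inputOf.liveCV`,
`dead := deadOf ℛ Φf W`, `nup := nupOf Φf mass W`). [folklore] -/
theorem upM_of_reading [∀ K, MeasurableSpace (X K)] (ℛ : HistReading I d) (Φf : HistFactors I d)
    (μ : (K : ℕ) → Measure (X K)) [∀ K, IsFiniteMeasure (μ K)] (Rp : (K : ℕ) → ℝ → Repr172R (𝒢 K) (I K))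
    {l₀ : ℝ} {K₀ : ℕ} (hR : HistRead ℛ Φf Rp l₀ K₀) {K : ℕ} (hK : K₀ ≤ K) {t : ℝ} (ht : |t| ≤ l₀)
    (hN : ∀ τ ∈ HIndex.termSet I K, (ℛ.inputOf.run K τ).NewOK)
    (hRm : ∀ τ ∈ HIndex.termSet I K, ∀ t k, (ℛ.inputOf.run K τ).Rm t k ≤ (ℛ.inputOf.run K τ).R t)
    (hRmS : ∀ τ ∈ HIndex.termSet I K, ∀ t k, (ℛ.inputOf.run K τ).Rm t (k + 1) ≤ (ℛ.inputOf.run K τ).R (t + 1))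
    (hRm2 : ∀ τ ∈ HIndex.termSet I K, ∀ t, 2 ≤ (ℛ.inputOf.run K τ).Rm t 1)
    (hD : ∀ τ ∈ HIndex.termSet I K, (ℛ.inputOf.run K τ).NewDisjoint)
    (hL0 : 0 < ℛ.L) (hL4 : 4 ≤ ℛ.L) (hdrop : ∀ m, DropCtl (ℛ.s K) m) (hR1 : ∀ t, 1 ≤ ℛ.R K t)
    {C : T4PrintedShapeBanking.Consts} (hn₁ : 13 ≤ C.n₁) (hE₂ : 0 ≤ C.E₂) (hE₃ : 0 ≤ C.E₃) {Lu : ℝ} (hLu0 : 0 < Lu)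
    {j : ℕ} (hj1 : 1 ≤ j) (hLu : ∀ t i, i ≤ j → Real.log (Φf.Λ K (t + i)) ≤ Lu * Real.log (Φf.Λ K t))
    (hsmall : (1122 : ℝ) ^ d * 16 * 21 ^ d * Lu ≤ 2 ^ j / 2)
    (huΦ : ∀ t, t ≤ K → Real.log (Φf.Λ K t) * (6 * (561 ^ d * j * Lu + 1122 ^ d * Lu)) ≤ floorK C K (ℛ.R K) t)
    (huE₂ : ∀ n, n ≤ K → Real.log (Φf.Λ K n) * (15 * 126 ^ d) ≤ C.E₂ * (ℛ.R K n : ℝ) ^ C.q')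
    (huE₃ : ∀ n, n ≤ K → Real.log (Φf.Λ K n) * (24 * 126 ^ d) ≤ C.E₃ * (ℛ.R K n : ℝ) ^ C.q')
    (hB : ∀ j d' n, 0 ≤ Φf.fB K j d' n) (hRf : ∀ h, 0 ≤ Φf.fR K h) {W : ℕ → ℝ} (hW : 0 < W K)
    (cellOf : ℕ → HIndex.Idx I → ℕ × Lab d → γ) (phys : ℕ → HIndex.Idx I → ℕ × Lab d → δ) (jstar : ℕ → ℕ)
    {FcM : ℕ → Finset (γ × Gen PEv × δ) → ℝ}
    (hFcM : ∀ τ ∈ HIndex.termSet I K, ∏ x ∈ (ℛ.inputOf.run K τ).histV.comp K,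
        Real.exp (lifeCost (dictWT Prod.fst (ℛ.R K) C.n₁) (costT Prod.fst C K (ℛ.R K))
            ((ℛ.inputOf.run K τ).pedMV.genT (K, x))) *
          Real.exp (birthWT Prod.fst (fun n => 2 ^ (d + 3) * Real.log (Φf.Λ K n))
            ((ℛ.inputOf.run K τ).pedMV.genT (K, x))) *
          evProd (Φf.fB K) (Φf.fR K) ((ℛ.inputOf.run K τ).pedMV.toPGen id (K, x)) ≤
      FcM K (kmemOf ℛ.inputOf.pedV ℛ.inputOf.liveCV cellOf phys K τ)) :
    ∀ k ∈ badGMems (memOf ℛ.inputOf.pedV ℛ.inputOf.liveCV cellOf) jstar (HIndex.termSet I)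
        (kmemOf ℛ.inputOf.pedV ℛ.inputOf.liveCV cellOf phys) K,
      ∀ τ ∈ fibre (kmemOf ℛ.inputOf.pedV ℛ.inputOf.liveCV cellOf phys) (HIndex.termSet I) K k,
        Repr172R.weight μ Rp t τ ≤ deadOf ℛ Φf W K t τ * FcM K k * nupOf Φf (fun K => (μ K).real Set.univ) W K t := by
  intro k _ τ hτ
  obtain ⟨hτT, hkτ⟩ := mem_fibre.1 hτ
  rw [← hkτ]
  obtain ⟨⟨a, h, l, c⟩, hp, hpe⟩ := Finset.mem_map.mp hτT
  have hτe : τ = ⟨K, a, (h, l, c)⟩ := hpe.symm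
  subst hτe
  -- the family's run of the term IS the run read off its history choice (`run_inputOf`, `rfl`), rewritten syntactically
  have hF := hFcM _ hτT
  simp only [HistReading.run_inputOf] at hF
  exact weight_le_deadOf_mul_mul_nupOf ℛ Φf μ Rp hR hK ht a (Finset.mem_sigma.mp hp).2 (hN _ hτT) (hRm _ hτT)
    (hRmS _ hτT) (hRm2 _ hτT) (hD _ hτT) hL0 hL4 hdrop hR1 hn₁ hE₂ hE₃ hLu0 hj1 hLu hsmall huΦ huE₂ huE₃ hB hRf hW
    cellOf phys hF

/-- **`deadM_nonneg` OF THE VS-WITNESS, SUPPLIED FROM THE READING** at a cutoff `K`: the dead weight is nonnegative on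
every term of every key fibre (nonnegative birth ∕ renewal factors, `0 ≤ W K`). [folklore] -/
theorem deadM_nonneg_of_reading (ℛ : HistReading I d) (Φf : HistFactors I d) {K : ℕ}
    (hB : ∀ j d' n, 0 ≤ Φf.fB K j d' n) (hRf : ∀ h, 0 ≤ Φf.fR K h) {W : ℕ → ℝ} (hW : 0 ≤ W K) (t : ℝ)
    (cellOf : ℕ → HIndex.Idx I → ℕ × Lab d → γ) (phys : ℕ → HIndex.Idx I → ℕ × Lab d → δ) (jstar : ℕ → ℕ) :
    ∀ k ∈ badGMems (memOf ℛ.inputOf.pedV ℛ.inputOf.liveCV cellOf) jstar (HIndex.termSet I)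
        (kmemOf ℛ.inputOf.pedV ℛ.inputOf.liveCV cellOf phys) K,
      ∀ τ ∈ fibre (kmemOf ℛ.inputOf.pedV ℛ.inputOf.liveCV cellOf phys) (HIndex.termSet I) K k,
        0 ≤ deadOf ℛ Φf W K t τ := by
  intro k _ τ hτ
  obtain ⟨hτT, -⟩ := mem_fibre.1 hτ
  obtain ⟨⟨a, h, l, c⟩, -, hpe⟩ := Finset.mem_map.mp hτT
  have hτe : τ = ⟨K, a, (h, l, c)⟩ := hpe.symm
  subst hτe
  exact deadOf_nonneg ℛ Φf hW hB hRf t a h l c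

/-- **`resumM` OF THE VS-WITNESS FROM THE LOCATED DISPLAY (ρ) `FibreMass`** (R-OWNER-46-1 (c): «`resumM` := (ρ) ∕ `W K`,
kernel, one line»): if, for every bad key class `k`, the fibre mass `Σ_{τ ∈ fibre k} DEAD(τ)·|wC(τ)|·e^{BV(τ)}` is at most
`W K · MULT K k` (the displayed (ρ), R-class, VOLUME type), then `Σ_{τ ∈ fibre k} deadOf ℛ Φf W K t τ ≤ MULT K k` —
the field `resumM` at `RfM := MULT`. [folklore] -/
theorem resumM_of_fibreMass (ℛ : HistReading I d) (Φf : HistFactors I d) {K : ℕ} {W : ℕ → ℝ} (hW : 0 < W K) (t : ℝ)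
    (cellOf : ℕ → HIndex.Idx I → ℕ × Lab d → γ) (phys : ℕ → HIndex.Idx I → ℕ × Lab d → δ) (jstar : ℕ → ℕ)
    {MULT : ℕ → Finset (γ × Gen PEv × δ) → ℝ}
    (hρ : ∀ k ∈ badGMems (memOf ℛ.inputOf.pedV ℛ.inputOf.liveCV cellOf) jstar (HIndex.termSet I)
        (kmemOf ℛ.inputOf.pedV ℛ.inputOf.liveCV cellOf phys) K,
      ∑ τ ∈ fibre (kmemOf ℛ.inputOf.pedV ℛ.inputOf.liveCV cellOf phys) (HIndex.termSet I) K k,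
        dmassOf ℛ Φf t τ ≤ W K * MULT K k) :
    ∀ k ∈ badGMems (memOf ℛ.inputOf.pedV ℛ.inputOf.liveCV cellOf) jstar (HIndex.termSet I)
        (kmemOf ℛ.inputOf.pedV ℛ.inputOf.liveCV cellOf phys) K,
      ∑ τ ∈ fibre (kmemOf ℛ.inputOf.pedV ℛ.inputOf.liveCV cellOf phys) (HIndex.termSet I) K k,
        deadOf ℛ Φf W K t τ ≤ MULT K k := by
  intro k hk
  have h1 := hρ k hk
  simp only [deadOf]
  rw [← Finset.sum_div, div_le_iff₀ hW, mul_comm]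
  exact h1

/-- **THE ENVELOPE FIELD `nup_bd`'s NONNEGATIVE HALF** for the reference measures' masses and `W ≥ 0`. [folklore] -/
theorem nupOf_measure_nonneg [∀ K, MeasurableSpace (X K)] (Φf : HistFactors I d) (μ : (K : ℕ) → Measure (X K))
    {W : ℕ → ℝ} (hW : ∀ K, 0 ≤ W K) (K : ℕ) (t : ℝ) : 0 ≤ nupOf Φf (fun K => (μ K).real Set.univ) W K t :=
  nupOf_nonneg Φf (fun _ => measureReal_nonneg) hW K t

end Fields

end

end Summit.QuantumFields.BalabanUV.T4Continuum.HistoryRealiseCellsRunSupplyWTVS
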